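import Mathlib
import HarnessLib
import Summits.CriticalPhenomena.CardyFormulaZ2.Theorems.CardyComplexConeEdgeCoherenceRotationDefs
import Summits.CriticalPhenomena.CardyFormulaZ2.Theorems.CardyComplexConeEdgePrecompactMedialExplorationShiftData
import Summits.CriticalPhenomena.CardyFormulaZ2.Theorems.CardyComplexConeCoherentMoreraCoherenceShift
import Summits.CriticalPhenomena.CardyFormulaZ2.Theorems.CardyComplexConeEdgeCoherenceDefs

/-!
# Exact `ℤ₄` rotation covariance of the medial exploration path (sub-goal `medialExploration_rotData`)
(line `Sketch`, composition `LeeYang`, crux `EdgeCoherence`, item stmt-CriticalPhenomena-11385)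

Route `CardyComplexCone` (sub-problem `CriticalPhenomena/CardyFormulaZ2`), crux
`Summit.CriticalPhenomena.CardyFormulaZ2.Theses.CardyComplexCone.EdgeCoherence`, registered sub-goal
`medialExploration_rotData` of the lead's rotational reformulation (definitions module
`…EdgeCoherenceRotationDefs`: `rotAbout`, `rotPlane`, `rotIso`, `rotData`): exploring the Dobrushin data
turned by a quarter turn about the lattice point `v` (`rotData E v`) in the turned configuration
`rotAbout v · ω` gives the turned path — for ALL data, without admissibility (when there is no unique
exploration both sides are the junk value `[]`).

Proof = conjugation. `rotAbout v = shift v ∘ R ∘ shift (−v)` and `rotData E v = shiftData (i · shiftData E (−v)) v`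
(`relabel_rotAbout`, `map_rotAbout`, `rotData_eq_shiftData` of the definitions module), so the statement is
the composite of the translation covariance `medialExploration_shiftData` (twice;
`…EdgePrecompactMedialExplorationShiftData`, item stmt-CriticalPhenomena-11387) and the quarter-turn covariance
about the ORIGIN. The latter exists in the tree for admissible data (`CoherenceShift.medialExploration_rot`,
pinned down by uniqueness); here it is re-proved WITHOUT admissibility (`medialExploration_rot_eq`) exactly as
the translation case: the forward transport of the predicate `IsMedialExploration` is the tree's
`CoherenceShift.isMedialExploration_rot_map` (built on the quarter-turn dictionary of
`…CardySelfRefinementLagHandOffRotationCorners/…RotationData`: corners, `cornerSource`/`cornerTarget` —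
orientation is preserved —, inner faces, boundary, arcs, `A`–`B` edges, boundary conditions, turning rule),
the converse transport `isMedialExploration_rot_symm_map` reads the same dictionary from right to left, and
unique existence / the chosen path are transported along the bijection of lists
(`medialExploration_eq_of_existsUnique`, `medialExploration_eq_nil`).

The file also records the face bookkeeping of the turn about `v` — the face with lower-left corner `f` goes
to the face with lower-left corner `rotAbout v f − e₀`, classes advance by one (`faceAt_rotAbout`),
`cornerSource`/`cornerTarget` are covariant (`cornerSource_rotAbout`, `cornerTarget_rotAbout`,
`cornerSource_faceAt_rotAbout`, `cornerTarget_faceAt_rotAbout`) —, the rigid motion of medial points and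
windings (`medialPoint_rotAbout`, `winding_map_rotPlane`, `winding_take_map_rotAbout`), and, with the
invariance of `P_{1/2}` (`bondPercolation_map_relabel_rotAbout` of the definitions module), the resulting
EXACT COVARIANCE OF THE CORNER OBSERVABLE in class form, `cornerObs_rotData_faceAt`:
`E_δ^{rotData E v}(rotAbout v w, faceAt (rotAbout v w) (c+1)) = E_δ^{E}(w, faceAt w c)` for all data (the
proof of `CoherenceShift.cornerObs_rot` verbatim, without admissibility).

References: S. Smirnov, C. R. Acad. Sci. Paris 333 (2001), §2 (the exploration path); S. Smirnov, Ann. of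
Math. 172 (2010), §2.2 (winding = total turning); G. Grimmett, *Percolation*, 2nd ed. (1999), §1.6 (lattice
symmetries); B. Bollobás, O. Riordan, *Percolation* (2006), Ch. 3.
-/

noncomputable section

namespace Summit.CriticalPhenomena.CardyFormulaZ2.Cruxes.EdgeCoherence.Rotation

open Literature.Probability.LatticeModels Literature.Probability.Percolation
open Summit.CriticalPhenomena.CardyFormulaZ2.Cruxes.EdgePrecompact.QkzStripBoundaryArm
  (shiftData medialExploration_shiftData medialExploration_eq_of_existsUnique medialExploration_eq_nil)
open Summit.CriticalPhenomena.CardyFormulaZ2.Cruxes.LagHandOff.HittingTournament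
  (isCorner_rot_iff cornerSource_rot cornerTarget_rot isMedialTurn_rot_iff isMedialStep_rot_iff
    bcBondConfig_rot mem_zdArcA_rot_iff rot_mem_zdABEdges_iff)
open Summit.CriticalPhenomena.CardyFormulaZ2.Cruxes.CoherentMorera.FinitaryGreenPairing.CoherenceShift
  (isMedialExploration_rot_map)

/-! ### The quarter turn about the origin, without admissibility -/

section Origin

variable {E E' : DiscreteDobrushin}
  (hΩ : E'.Ω = (fun z => Complex.I * z) '' E.Ω) (hδ : E'.δ = E.δ)
  (hA : E'.arcA = (fun z => Complex.I * z) '' E.arcA)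
  (hB : E'.arcB = (fun z => Complex.I * z) '' E.arcB)
include hΩ hδ hA hB

/-- **Converse transport of structure**: an exploration path of the turned configuration in the
turned data, turned back, is an exploration path of the configuration in the data (the tree's
quarter-turn dictionary read from right to left). -/
theorem isMedialExploration_rot_symm_map {ω : BondConfig (Site 2)} {γ' : List MedialVertex}
    (h : IsMedialExploration E' (BondConfig.relabel (sym2Equiv rotCell) ω) γ') :
    IsMedialExploration E ω (γ'.map (sym2Equiv rotCell).symm) := by
  have hforth : ∀ l : List MedialVertex,
      (l.map (sym2Equiv rotCell).symm).map (sym2Equiv rotCell) = l := fun l => by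
    rw [List.map_map, Equiv.self_comp_symm, List.map_id]
  have hne : γ'.map (sym2Equiv rotCell).symm ≠ [] := by simpa using h.ne_nil
  refine ⟨hne, ?_, ?_, ?_, ?_, ?_, ?_, ?_⟩
  · intro e e' hinf
    have h2 := hinf.map (sym2Equiv rotCell)
    rw [hforth] at h2
    exact (isMedialStep_rot_iff hΩ hδ e e').1 (h.step _ _ h2)
  · intro e₀ e₁ e₂ hinf
    have h2 := hinf.map (sym2Equiv rotCell)
    rw [hforth] at h2
    have h3 := h.turn _ _ _ h2
    rw [bcBondConfig_rot hΩ hδ hA hB] at h3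
    exact (isMedialTurn_rot_iff (E.bcBondConfig ω) e₀ e₁ e₂).1 h3
  · rw [← List.map_tail, List.zip_map]
    exact h.nodup.map ((sym2Equiv rotCell).symm.injective.prodMap (sym2Equiv rotCell).symm.injective)
  · rw [List.head_map]
    refine (rot_mem_zdABEdges_iff hΩ hδ hA hB _).1 ?_
    rw [Equiv.apply_symm_apply]
    exact h.head_mem
  · rw [List.getLast_map]
    refine (rot_mem_zdABEdges_iff hΩ hδ hA hB _).1 ?_
    rw [Equiv.apply_symm_apply]
    exact h.getLast_mem
  · rw [List.head_map, List.getLast_map]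
    exact fun heq => h.head_ne_getLast ((sym2Equiv rotCell).symm.injective heq)
  · intro e e' hpre
    have h2 := hpre.map (sym2Equiv rotCell)
    rw [hforth] at h2
    obtain ⟨v₁, f₁, hc, hs, ht, hvA⟩ := h.start _ _ h2
    obtain ⟨v, rfl⟩ := rotCell.surjective v₁
    obtain ⟨f, rfl⟩ := CellSymmetry.rot.face.surjective f₁
    rw [isCorner_rot_iff] at hc
    rw [cornerSource_rot hc] at hs
    rw [cornerTarget_rot hc] at ht
    exact ⟨v, f, hc, (sym2Equiv rotCell).injective hs, (sym2Equiv rotCell).injective ht,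
      (mem_zdArcA_rot_iff hΩ hδ hA v).1 hvA⟩

/-- **Transport of the exploration predicate under the quarter turn about the origin, as an
equivalence** (no admissibility). -/
theorem isMedialExploration_rot_iff (ω : BondConfig (Site 2)) (γ' : List MedialVertex) :
    IsMedialExploration E' (BondConfig.relabel (sym2Equiv rotCell) ω) γ' ↔
      IsMedialExploration E ω (γ'.map (sym2Equiv rotCell).symm) := by
  constructor
  · exact isMedialExploration_rot_symm_map hΩ hδ hA hB
  · intro h
    have h2 := isMedialExploration_rot_map hΩ hδ hA hB h
    rwa [List.map_map, Equiv.self_comp_symm, List.map_id] at h2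

/-- **Quarter-turn covariance of the medial exploration path about the origin, WITHOUT
admissibility**: unique existence and the chosen path are transported along the bijection of
lists (without a unique exploration both sides are the junk value `[]`), exactly as for
translations (`medialExploration_shiftData`); compare `CoherenceShift.medialExploration_rot`
(admissible data). -/
theorem medialExploration_rot_eq (ω : BondConfig (Site 2)) :
    medialExploration E' (BondConfig.relabel (sym2Equiv rotCell) ω) =
      (medialExploration E ω).map (sym2Equiv rotCell) := by
  -- adapted from `medialExploration_shiftData` of `…EdgePrecompactMedialExplorationShiftData`
  by_cases h : ∃! γ, IsMedialExploration E ω γ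
  · obtain ⟨γ, hγ, huniq⟩ := id h
    have h' : ∃! γ', IsMedialExploration E' (BondConfig.relabel (sym2Equiv rotCell) ω) γ' := by
      refine ⟨_, isMedialExploration_rot_map hΩ hδ hA hB hγ, fun γ' hγ' => ?_⟩
      rw [← huniq _ ((isMedialExploration_rot_iff hΩ hδ hA hB ω γ').1 hγ'), List.map_map,
        Equiv.self_comp_symm, List.map_id]
    rw [medialExploration_eq_of_existsUnique h' (isMedialExploration_rot_map hΩ hδ hA hB hγ),
      medialExploration_eq_of_existsUnique h hγ]
  · have h' : ¬ ∃! γ', IsMedialExploration E' (BondConfig.relabel (sym2Equiv rotCell) ω) γ' := by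
      rintro ⟨γ', hγ', huniq⟩
      refine h ⟨_, (isMedialExploration_rot_iff hΩ hδ hA hB ω γ').1 hγ', fun γ hγ => ?_⟩
      rw [← huniq _ (isMedialExploration_rot_map hΩ hδ hA hB hγ), List.map_map, Equiv.symm_comp_self,
        List.map_id]
    rw [medialExploration_eq_nil h', medialExploration_eq_nil h, List.map_nil]

end Origin

/-- The origin case, for the explicitly turned data `⟨i·Ω, δ, i·A, i·B⟩`. -/
theorem medialExploration_rotOrigin (E : DiscreteDobrushin) (ω : BondConfig (Site 2)) :
    medialExploration ⟨(fun z => Complex.I * z) '' E.Ω, E.δ, (fun z => Complex.I * z) '' E.arcA,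
        (fun z => Complex.I * z) '' E.arcB⟩ (BondConfig.relabel (sym2Equiv rotCell) ω) =
      (medialExploration E ω).map (sym2Equiv rotCell) :=
  medialExploration_rot_eq (E := E) (E' := ⟨(fun z => Complex.I * z) '' E.Ω, E.δ,
    (fun z => Complex.I * z) '' E.arcA, (fun z => Complex.I * z) '' E.arcB⟩) rfl rfl rfl rfl ω

/-! ### Face bookkeeping and rigid motion of the turn about `v` (for the corner observable) -/

section Corners

open Summit.CriticalPhenomena.CardyFormulaZ2.Cruxes.EdgePrecompact.QkzStripBoundaryArm
  (isCorner_add_iff cornerSource_add cornerTarget_add winding_map_add_const)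
open Summit.CriticalPhenomena.CardyFormulaZ2.Cruxes.LagHandOff.HittingTournament
  (rotCell_sub rotCell_cornerOff rot_face_apply faceAt_rotCell meshPoint_rotCell)
open Summit.CriticalPhenomena.CardyFormulaZ2.Cruxes.CoherentMorera.FinitaryGreenPairing.CoherenceShift
  (medialPoint_rot winding_map_mul_I)

/-- **The face action of the turn about `v`**: the unit square with lower-left corner `f` is carried
onto the unit square with lower-left corner `rotAbout v f − e₀`; conjugation form
`rotAbout v f − e₀ = shift v (rot.face (shift (−v) f))` (`CellSymmetry.rot.face g = R g − e₀`). -/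
theorem rotAbout_sub_single_eq (v f : Site 2) :
    rotAbout v f - Pi.single 0 1 = Site.shift v (CellSymmetry.rot.face (Site.shift (-v) f)) := by
  rw [rot_face_apply, Site.shift_apply, Site.shift_apply, rotAbout_apply, ← sub_eq_add_neg,
    ← sub_eq_add_neg]
  abel

/-- Being a corner is invariant: `w` is a corner of the face `f` iff `rotAbout v w` is a corner of
the face `rotAbout v f − e₀`. -/
theorem isCorner_rotAbout_iff (v w f : Site 2) :
    IsCorner (rotAbout v w) (rotAbout v f - Pi.single 0 1) ↔ IsCorner w f := by
  rw [rotAbout_sub_single_eq, rotAbout_eq_shift_rotCell_shift]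
  simp only [Site.shift_apply]
  rw [isCorner_add_iff, isCorner_rot_iff, isCorner_add_iff]

/-- **Classes advance by one**: the `k`-th face at `w` is carried onto the `(k+1)`-st face at
`rotAbout v w`: `faceAt (rotAbout v w) (k + 1) = rotAbout v (faceAt w k) − e₀`. -/
theorem faceAt_rotAbout (v w : Site 2) (k : Fin 4) :
    faceAt (rotAbout v w) (k + 1) = rotAbout v (faceAt w k) - Pi.single 0 1 := by
  rw [faceAt, faceAt, rotAbout_apply, rotAbout_apply, sub_right_comm w (cornerOff k) v,
    rotCell_sub (w - v) (cornerOff k), rotCell_cornerOff]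
  abel

/-- `cornerSource` is covariant under the turn about `v` (the turn preserves orientation, hence the
counter-clockwise order of the two edges of a face at a corner). -/
theorem cornerSource_rotAbout (v : Site 2) {w f : Site 2} (h : IsCorner w f) :
    cornerSource (rotAbout v w) (rotAbout v f - Pi.single 0 1) =
      sym2Equiv (rotAbout v) (cornerSource w f) := by
  have h' : IsCorner (w + -v) (f + -v) := (isCorner_add_iff w f (-v)).2 h
  rw [rotAbout_sub_single_eq, rotAbout_eq_shift_rotCell_shift, sym2Equiv_rotAbout_apply]
  simp only [Site.shift_apply]
  rw [cornerSource_add, cornerSource_rot h', cornerSource_add]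

/-- `cornerTarget` is covariant under the turn about `v`. -/
theorem cornerTarget_rotAbout (v : Site 2) {w f : Site 2} (h : IsCorner w f) :
    cornerTarget (rotAbout v w) (rotAbout v f - Pi.single 0 1) =
      sym2Equiv (rotAbout v) (cornerTarget w f) := by
  have h' : IsCorner (w + -v) (f + -v) := (isCorner_add_iff w f (-v)).2 h
  rw [rotAbout_sub_single_eq, rotAbout_eq_shift_rotCell_shift, sym2Equiv_rotAbout_apply]
  simp only [Site.shift_apply]
  rw [cornerTarget_add, cornerTarget_rot h', cornerTarget_add]

/-- The source/target pair of the class-`c` corner at `w` is carried onto that of the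
class-`(c+1)` corner at `rotAbout v w`. -/
theorem cornerSource_faceAt_rotAbout (v w : Site 2) (k : Fin 4) :
    cornerSource (rotAbout v w) (faceAt (rotAbout v w) (k + 1)) =
      sym2Equiv (rotAbout v) (cornerSource w (faceAt w k)) := by
  rw [faceAt_rotAbout, cornerSource_rotAbout v (isCorner_faceAt w k)]

/-- Target version of `cornerSource_faceAt_rotAbout`. -/
theorem cornerTarget_faceAt_rotAbout (v w : Site 2) (k : Fin 4) :
    cornerTarget (rotAbout v w) (faceAt (rotAbout v w) (k + 1)) =
      sym2Equiv (rotAbout v) (cornerTarget w (faceAt w k)) := by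
  rw [faceAt_rotAbout, cornerTarget_rotAbout v (isCorner_faceAt w k)]

/-- **Medial points turn rigidly**: the medial point of the turned medial vertex is the turned
medial point. -/
theorem medialPoint_rotAbout (δ : ℝ) (v : Site 2) (e : MedialVertex) :
    medialPoint δ (sym2Equiv (rotAbout v) e) = rotPlane (meshPoint δ v) (medialPoint δ e) := by
  induction e using Sym2.ind with
  | h x y =>
    rw [sym2Equiv_mk, medialPoint_mk, medialPoint_mk, meshPoint_rotAbout, meshPoint_rotAbout]
    simp only [rotPlane]
    ring

/-- The polyline winding is invariant under the quarter turn of the plane about `c` (composition of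
the invariances under `z ↦ z + c'` and `z ↦ i z`; Smirnov 2010, §2.2). -/
theorem winding_map_rotPlane (c : ℂ) (l : List ℂ) :
    Polyline.winding (l.map (rotPlane c)) = Polyline.winding l := by
  rw [show rotPlane c = (· + c) ∘ (fun z => Complex.I * z) ∘ (· + -c) from
      funext fun z => by simp only [Function.comp_apply, rotPlane, ← sub_eq_add_neg]; ring,
    ← List.map_map, ← List.map_map, winding_map_add_const, winding_map_mul_I, winding_map_add_const]

/-- The winding read along (a prefix of) a turned medial path equals the winding along the path. -/
theorem winding_take_map_rotAbout (δ : ℝ) (v : Site 2) (γ : List MedialVertex) (n : ℕ) :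
    Polyline.winding (((γ.map (sym2Equiv (rotAbout v))).map (medialPoint δ)).take n) =
      Polyline.winding ((γ.map (medialPoint δ)).take n) := by
  rw [List.map_map, show medialPoint δ ∘ (sym2Equiv (rotAbout v)) =
      rotPlane (meshPoint δ v) ∘ medialPoint δ from funext (medialPoint_rotAbout δ v), ← List.map_map,
    ← List.map_take, winding_map_rotPlane]

end Corners

/-- **Exact `ℤ₄` rotation covariance of the medial exploration path** (registered sub-goal
`medialExploration_rotData`): exploring the data turned by a quarter turn about the lattice point
`v` in the turned configuration gives the turned path. Conjugation of the origin case
(`medialExploration_rot_eq`) by the translation covariance `medialExploration_shiftData`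
(`rotAbout v = shift v ∘ R ∘ shift (−v)`, `rotData E v = shiftData (R · (shiftData E (−v))) v`).
True without admissibility (both sides are `[]` when there is no unique exploration). -/
theorem medialExploration_rotData : ∀ (E : DiscreteDobrushin) (v : Site 2) (ω : BondConfig (Site 2)), medialExploration (rotData E v) (BondConfig.relabel (sym2Equiv (rotAbout v)) ω) = (medialExploration E ω).map (sym2Equiv (rotAbout v)) := by
  intro E v ω
  rw [relabel_rotAbout, map_rotAbout, rotData_eq_shiftData, medialExploration_shiftData,
    medialExploration_rotOrigin, medialExploration_shiftData]


/-! ### Covariance of the corner observable (towards the follow-up `cornerObs_rotData`) -/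

section CornerObs

open MeasureTheory Filter
open Summit.CriticalPhenomena.CardyFormulaZ2.Cruxes.EdgeCoherence.FixedRadiusCut (cornerObs)
open Summit.CriticalPhenomena.CardyFormulaZ2.Cruxes.EdgePrecompact.QkzStripBoundaryArm
  (option_map_eq_some_apply_iff)

/-- **Exact quarter-turn covariance of the corner observable about a lattice point** (class form):
the class-`c` corner value `E_δ(w, faceAt w c)` of the data `E` is the class-`(c+1)` corner value at
`rotAbout v w` of the turned data `rotData E v`, for ALL data and meshes (no admissibility). Measure
step: `P_{1/2}` is invariant under `rotAbout v` (`bondPercolation_map_relabel_rotAbout`,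
`integral_map_equiv`); pointwise step: `medialExploration_rotData` and the rigid transport of the
integrand (`cornerSource_faceAt_rotAbout`, `cornerTarget_faceAt_rotAbout`, `winding_take_map_rotAbout`).
Here `cornerObs` is the crux's `FixedRadiusCut.cornerObs` (`…EdgeCoherenceDefs`). -/
theorem cornerObs_rotData_faceAt (E : DiscreteDobrushin) (δ : ℝ) (v w : Site 2) (c : Fin 4) :
    cornerObs (rotData E v) δ (rotAbout v w) (faceAt (rotAbout v w) (c + 1)) =
      cornerObs E δ w (faceAt w c) := by
  -- adapted from `CoherenceShift.cornerObs_rot`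
  unfold cornerObs
  conv_lhs => rw [← bondPercolation_map_relabel_rotAbout v half]
  rw [integral_map_equiv]
  refine integral_congr_ae (Eventually.of_forall fun ω => ?_)
  simp only []
  rw [medialExploration_rotData E v ω]
  simp only [List.length_map, List.getElem?_map, cornerSource_faceAt_rotAbout,
    cornerTarget_faceAt_rotAbout, option_map_eq_some_apply_iff (sym2Equiv (rotAbout v)).injective,
    winding_take_map_rotAbout]

end CornerObs

end Summit.CriticalPhenomena.CardyFormulaZ2.Cruxes.EdgeCoherence.Rotation

end
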